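import Literature.Analysis.Matrix.FiniteRangeDecompositionBeyond
import Literature.Analysis.Matrix.FiniteRangeDecompositionPseudoInverse
import HarnessLib

/-!
# Volume-uniform decay of the torus Green's function gradients, I: finite range, geometric tails, the core assembly

`Literature/Analysis/Matrix/`; preparatory layer for `TorusGreenGradientDecay.lean`.  On the abstract anisotropic three-torus
(finite abelian group `G`, steps `e₀,e₁,e₂` of orders dividing `L₀ = L₁ = L ≤ L₂ = M` determining the characters,
translation-invariant symmetric `A` with `0 ≤ A ≤ 4` and coercive symbol `c₀ Σ_i (2 − 2Re ψ(e_i)) ≤ σ_A(ψ)`):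

* `rowDiffs_apply_eq_zero_of_lt_dist` — iterated differences of a kernel of finite range `ρ` vanish at separation `> ρ + |l|`;
* `tsum_indicator_inv_two_pow_le` — the geometric tail over dyadic scales, `Σ_{N : c ≤ 2^N} 2^{−Nq} ≤ 2 max(1,c)^{−q}`;
* `symbol_re_ge_of_ne_one` (spectral gap `16c₀/M²` off the trivial character), `symbol_eq_zero_iff_eq_one` (kernel = constants
  given zero row sum), `symbol_one_eq_zero_of_sum_eq_zero`;
* **`abs_rowDiffs_pinv_le_core`** — if the pieces `C^{(m)}_N` vanish at `(x,y)` below the scale `θ`, obey `K₃2^{−Nq}` up to the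
  scale `Λ` and `K_f 2^{−Np}E` above it, then `|∇_l pinv A (x,y)| ≤ 2K₃ max(1,θ)^{−q} + 2K_f max(1,θ,Λ)^{−p} E`
  (via `abs_rowDiffs_pinv_le_tsum`).

All [folklore].
-/

noncomputable section

open Finset Real
open Literature.Analysis.Fourier Literature.Analysis.Fourier.TrigApprox

namespace Literature.Analysis.Matrix

variable {G : Type*} [AddCommGroup G] [Fintype G] [DecidableEq G]

/-! ## Finite range kills the small scales at a given separation -/

section FiniteRange

omit [Fintype G] [DecidableEq G] in
/-- **Iterated differences of a finite-range kernel vanish beyond the range**: if `C` has range `ρ` for a pseudo-distance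
with the triangle inequality in which every step of `l` has length `≤ 1`, then `∇_l C (x,y) = 0` whenever `d(x,y) > ρ + |l|`.
[folklore] -/
theorem rowDiffs_apply_eq_zero_of_lt_dist {d : G → G → ℕ} (htri : ∀ i j k, d i k ≤ d i j + d j k) {ρ : ℕ}
    {C : _root_.Matrix G G ℝ} (hC : HasFiniteRange d ρ C) :
    ∀ {l : List G}, (∀ g ∈ l, ∀ x, d x (x + g) ≤ 1) → ∀ {x y : G}, ρ + l.length < d x y → rowDiffs l C x y = 0
  | [], _, x, y, hxy => by
    rw [rowDiffs_nil]
    exact hC x y (by simpa using hxy)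
  | g :: l, hl, x, y, hxy => by
    rw [rowDiffs_cons, rowDiff_apply]
    have hl' : ∀ g' ∈ l, ∀ x, d x (x + g') ≤ 1 := fun g' hg' => hl g' (List.mem_cons_of_mem g hg')
    have h1 : ρ + l.length < d x y := by
      have : (g :: l).length = l.length + 1 := rfl
      omega
    have h2 : ρ + l.length < d (x + g) y := by
      have ht := htri x (x + g) y
      have hs := hl g List.mem_cons_self x
      have : (g :: l).length = l.length + 1 := rfl
      omega
    rw [rowDiffs_apply_eq_zero_of_lt_dist htri hC hl' h2, rowDiffs_apply_eq_zero_of_lt_dist htri hC hl' h1, sub_zero]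

end FiniteRange

/-! ## Geometric tails over dyadic scales -/

section Tails

/-- The dyadic tail indicator series is dominated by a geometric series. [folklore] -/
theorem indicator_inv_two_pow_le (c : ℝ) {q : ℕ} (hq : 1 ≤ q) (N : ℕ) :
    (if c ≤ (2 : ℝ) ^ N then ((1 : ℝ) / 2 ^ N) ^ q else 0) ≤ (1 / 2 : ℝ) ^ N := by
  split_ifs
  · calc ((1 : ℝ) / 2 ^ N) ^ q ≤ ((1 : ℝ) / 2 ^ N) ^ 1 :=
          pow_le_pow_of_le_one (by positivity) (by rw [div_le_one (by positivity)]; exact one_le_pow₀ (by norm_num)) hq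
      _ = (1 / 2 : ℝ) ^ N := by rw [pow_one, one_div_pow]
  · positivity

/-- The dyadic tail indicator series is summable. [folklore] -/
theorem summable_indicator_inv_two_pow (c : ℝ) {q : ℕ} (hq : 1 ≤ q) :
    Summable fun N : ℕ => if c ≤ (2 : ℝ) ^ N then ((1 : ℝ) / 2 ^ N) ^ q else 0 :=
  Summable.of_nonneg_of_le (fun N => by split_ifs <;> positivity) (indicator_inv_two_pow_le c hq)
    (summable_geometric_of_lt_one (by norm_num) (by norm_num))

/-- **Geometric tail over the dyadic scales above a threshold**: `Σ_{N : c ≤ 2^N} 2^{−Nq} ≤ 2·max(1,c)^{−q}` (`q ≥ 1`).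
[folklore] -/
theorem tsum_indicator_inv_two_pow_le (c : ℝ) {q : ℕ} (hq : 1 ≤ q) :
    ∑' N : ℕ, (if c ≤ (2 : ℝ) ^ N then ((1 : ℝ) / 2 ^ N) ^ q else 0) ≤ 2 * (1 / max 1 c) ^ q := by
  classical
  -- the first scale above the threshold
  have hex : ∃ N : ℕ, c ≤ (2 : ℝ) ^ N := by
    obtain ⟨N, hN⟩ := pow_unbounded_of_one_lt c (by norm_num : (1 : ℝ) < 2)
    exact ⟨N, hN.le⟩
  set N₀ := Nat.find hex with hN₀
  have hN₀spec : c ≤ (2 : ℝ) ^ N₀ := Nat.find_spec hex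
  have hmin : ∀ N, c ≤ (2 : ℝ) ^ N → N₀ ≤ N := fun N hN => Nat.find_min' hex hN
  set r : ℝ := ((1 : ℝ) / 2) ^ q with hr
  have hr0 : 0 ≤ r := by positivity
  have hr1 : r < 1 := pow_lt_one₀ (by norm_num) (by norm_num) (by omega)
  have hrhalf : r ≤ 1 / 2 := by
    calc r ≤ ((1 : ℝ) / 2) ^ 1 := pow_le_pow_of_le_one (by norm_num) (by norm_num) hq
      _ = 1 / 2 := pow_one _
  -- termwise domination by the shifted geometric sequence
  set f : ℕ → ℝ := fun N => if c ≤ (2 : ℝ) ^ N then ((1 : ℝ) / 2 ^ N) ^ q else 0 with hf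
  set g : ℕ → ℝ := fun N => if N₀ ≤ N then r ^ N else 0 with hg
  have hfg : ∀ N, f N ≤ g N := by
    intro N
    simp only [hf, hg]
    by_cases hc : c ≤ (2 : ℝ) ^ N
    · rw [if_pos hc, if_pos (hmin N hc)]
      have : ((1 : ℝ) / 2 ^ N) ^ q = r ^ N := by
        rw [hr]; simp only [one_div_pow]; rw [← pow_mul, ← pow_mul, mul_comm]
      rw [this]
    · rw [if_neg hc]; split_ifs <;> positivity
  have hgsum : Summable g := by
    refine Summable.of_nonneg_of_le (fun N => by simp only [hg]; split_ifs <;> positivity) (fun N => ?_)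
      (summable_geometric_of_lt_one hr0 hr1)
    simp only [hg]; split_ifs <;> [exact le_rfl; positivity]
  have hfsum : Summable f := summable_indicator_inv_two_pow c hq
  -- the value of the geometric tail
  have hgval : ∑' N, g N = r ^ N₀ * (1 - r)⁻¹ := by
    rw [← Summable.sum_add_tsum_nat_add N₀ hgsum]
    have h1 : ∑ i ∈ Finset.range N₀, g i = 0 := Finset.sum_eq_zero fun i hi => by
      simp only [hg]; rw [if_neg (by have := Finset.mem_range.1 hi; omega)]
    have h2 : (fun i => g (i + N₀)) = fun i => r ^ N₀ * r ^ i := by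
      funext i; simp only [hg]; rw [if_pos (by omega), pow_add, mul_comm]
    rw [h1, zero_add, h2, tsum_mul_left, tsum_geometric_of_lt_one hr0 hr1]
  -- `r^{N₀} ≤ max(1,c)^{−q}` because `2^{N₀} ≥ max(1,c)`
  have hpow : r ^ N₀ ≤ (1 / max 1 c) ^ q := by
    rw [hr, ← pow_mul, mul_comm, pow_mul, one_div_pow]
    have h2N : max 1 c ≤ (2 : ℝ) ^ N₀ := max_le (one_le_pow₀ (by norm_num)) hN₀spec
    have : (1 : ℝ) / 2 ^ N₀ ≤ 1 / max 1 c := one_div_le_one_div_of_le (by positivity) h2N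
    exact pow_le_pow_left₀ (by positivity) this q
  calc ∑' N, f N ≤ ∑' N, g N := hfsum.tsum_le_tsum hfg hgsum
    _ = r ^ N₀ * (1 - r)⁻¹ := hgval
    _ ≤ (1 / max 1 c) ^ q * 2 := by
        refine mul_le_mul hpow ?_ (inv_nonneg.2 (by linarith)) (by positivity)
        rw [inv_le_comm₀ (by linarith) (by norm_num)]
        linarith
    _ = 2 * (1 / max 1 c) ^ q := mul_comm _ _

end Tails

/-! ## The setting: coercivity consequences -/

section Setting

variable {A : _root_.Matrix G G ℝ}

omit [DecidableEq G] in
/-- **The spectral gap off the trivial character**: under the coercivity hypothesis every non-trivial character has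
`σ_A(ψ) ≥ 16c₀/M²` (`M = L₂` the longest period). [folklore] -/
theorem symbol_re_ge_of_ne_one (e : Fin 3 → G) (Ls : Fin 3 → ℕ) (hL : ∀ i, Ls i ≠ 0) (he : ∀ i, Ls i • e i = 0)
    (hgen : ∀ ψ φ : AddChar G ℂ, (∀ i, ψ (e i) = φ (e i)) → ψ = φ) (hL01 : Ls 1 = Ls 0) (hLM : Ls 0 ≤ Ls 2)
    {c₀ : ℝ} (hc₀ : 0 < c₀) (hcoer : ∀ ψ : AddChar G ℂ, c₀ * ∑ i, (2 - 2 * (ψ (e i)).re) ≤ (symbol A ψ).re)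
    (ψ : AddChar G ℂ) (hψ : ψ ≠ 1) : 16 * c₀ / (Ls 2 : ℝ) ^ 2 ≤ (symbol A ψ).re := by
  -- some index is non-zero
  obtain ⟨i, hi⟩ : ∃ i, addCharIndex (Ls i) (e i) ψ ≠ 0 := by
    by_contra h
    push Not at h
    exact hψ (eq_one_of_index_eq_zero e Ls hL he hgen ψ h)
  have hMpos : (0 : ℝ) < (Ls 2 : ℝ) := Nat.cast_pos.mpr (Nat.pos_of_ne_zero (hL 2))
  have hLi : (Ls i : ℝ) ≤ (Ls 2 : ℝ) := by
    fin_cases i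
    · exact_mod_cast hLM
    · simp only [Fin.mk_one]; rw [hL01]; exact_mod_cast hLM
    · exact le_rfl
  have hLipos : (0 : ℝ) < (Ls i : ℝ) := Nat.cast_pos.mpr (Nat.pos_of_ne_zero (hL i))
  have ht : 1 / (Ls i : ℝ) ≤ |addCharMomentum (Ls i) (e i) ψ| := inv_le_abs_addCharMomentum_of_index_ne_zero (hL i) ψ hi
  have h16 := sixteen_mul_sq_le (hL i) (he i) ψ
  have hsum : 2 - 2 * (ψ (e i)).re ≤ ∑ j, (2 - 2 * (ψ (e j)).re) :=
    Finset.single_le_sum (fun j _ => two_sub_two_re_nonneg (hL j) (he j) ψ) (Finset.mem_univ i)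
  have hM2 : 1 / (Ls 2 : ℝ) ≤ 1 / (Ls i : ℝ) := one_div_le_one_div_of_le hLipos hLi
  have hsq : (1 / (Ls 2 : ℝ)) ^ 2 ≤ addCharMomentum (Ls i) (e i) ψ ^ 2 := by
    calc (1 / (Ls 2 : ℝ)) ^ 2 ≤ (1 / (Ls i : ℝ)) ^ 2 := pow_le_pow_left₀ (by positivity) hM2 2
      _ ≤ |addCharMomentum (Ls i) (e i) ψ| ^ 2 := pow_le_pow_left₀ (by positivity) ht 2
      _ = addCharMomentum (Ls i) (e i) ψ ^ 2 := sq_abs _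
  calc 16 * c₀ / (Ls 2 : ℝ) ^ 2 = c₀ * (16 * (1 / (Ls 2 : ℝ)) ^ 2) := by rw [one_div_pow]; ring
    _ ≤ c₀ * (16 * addCharMomentum (Ls i) (e i) ψ ^ 2) := by gcongr
    _ ≤ c₀ * (2 - 2 * (ψ (e i)).re) := by gcongr
    _ ≤ c₀ * ∑ j, (2 - 2 * (ψ (e j)).re) := by gcongr
    _ ≤ (symbol A ψ).re := hcoer ψ

omit [DecidableEq G] in
/-- The kernel of `A` is exactly the constants: `σ_A(ψ) = 0 ↔ ψ = 1` (coercivity plus zero row sum). [folklore] -/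
theorem symbol_eq_zero_iff_eq_one (e : Fin 3 → G) (Ls : Fin 3 → ℕ) (hL : ∀ i, Ls i ≠ 0) (he : ∀ i, Ls i • e i = 0)
    (hgen : ∀ ψ φ : AddChar G ℂ, (∀ i, ψ (e i) = φ (e i)) → ψ = φ) (hL01 : Ls 1 = Ls 0) (hLM : Ls 0 ≤ Ls 2)
    {c₀ : ℝ} (hc₀ : 0 < c₀) (hcoer : ∀ ψ : AddChar G ℂ, c₀ * ∑ i, (2 - 2 * (ψ (e i)).re) ≤ (symbol A ψ).re)
    (h1 : symbol A 1 = 0) (ψ : AddChar G ℂ) : symbol A ψ = 0 ↔ ψ = 1 := by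
  constructor
  · intro h
    by_contra hψ
    have hge := symbol_re_ge_of_ne_one e Ls hL he hgen hL01 hLM hc₀ hcoer ψ hψ
    rw [h, Complex.zero_re] at hge
    have : (0 : ℝ) < 16 * c₀ / (Ls 2 : ℝ) ^ 2 := by
      have : (0 : ℝ) < (Ls 2 : ℝ) := Nat.cast_pos.mpr (Nat.pos_of_ne_zero (hL 2))
      positivity
    linarith
  · rintro rfl; exact h1

omit [DecidableEq G] in
/-- Zero row sum means `σ_A(1) = 0`. [folklore] -/
theorem symbol_one_eq_zero_of_sum_eq_zero (hrow : ∑ y, A 0 y = 0) : symbol A 1 = 0 := by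
  unfold symbol
  simp only [AddChar.one_apply, mul_one]
  exact_mod_cast hrow

end Setting

/-! ## The core assembly -/

section Core

variable {A : _root_.Matrix G G ℝ}

/-- **Core assembly**: if the pieces vanish at `(x,y)` below the scale `θ`, obey `K₃ 2^{−Nq}` up to the scale `Λ` and
`K_f 2^{−Np}·E` above it (`q, p ≥ 1`), then
`|∇_l pinv A (x,y)| ≤ 2K₃ max(1,θ)^{−q} + 2K_f max(1,θ,Λ)^{−p} E`. [folklore] -/
theorem abs_rowDiffs_pinv_le_core
    (hA : IsTranslationInvariant A) (hs : A.IsHermitian) (hP : A.PosSemidef)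
    (h4 : ((4 : ℝ) • (1 : _root_.Matrix G G ℝ) - A).PosSemidef)
    (h0 : ∀ ψ : AddChar G ℂ, symbol A ψ = 0 ↔ ψ = 1)
    {a₀ : ℝ} (ha₀ : 0 < a₀) (hmin : ∀ ψ : AddChar G ℂ, ψ ≠ 1 → a₀ ≤ (symbol A ψ).re)
    {m : ℕ} (hm : 1 ≤ m) {l : List G} (hl : l ≠ []) (x y : G)
    {K₃ Kf E θ Λ : ℝ} (hK₃ : 0 ≤ K₃) (hKf : 0 ≤ Kf) (hE : 0 ≤ E) {p q : ℕ} (hp : 1 ≤ p) (hq : 1 ≤ q)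
    (hvan : ∀ N : ℕ, (2 : ℝ) ^ N < θ → rowDiffs l (frdPiecePow A m N) x y = 0)
    (h3D : ∀ N : ℕ, (2 : ℝ) ^ N ≤ Λ → |rowDiffs l (frdPiecePow A m N) x y| ≤ K₃ * ((1 : ℝ) / 2 ^ N) ^ q)
    (hfar : ∀ N : ℕ, Λ < (2 : ℝ) ^ N → |rowDiffs l (frdPiecePow A m N) x y| ≤ Kf * ((1 : ℝ) / 2 ^ N) ^ p * E) :
    |rowDiffs l (pinv A) x y| ≤ 2 * K₃ * (1 / max 1 θ) ^ q + 2 * Kf * (1 / max 1 (max θ Λ)) ^ p * E := by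
  classical
  set b₁ : ℕ → ℝ := fun N => K₃ * (if θ ≤ (2 : ℝ) ^ N then ((1 : ℝ) / 2 ^ N) ^ q else 0) with hb₁
  set b₂ : ℕ → ℝ := fun N => Kf * E * (if max θ Λ ≤ (2 : ℝ) ^ N then ((1 : ℝ) / 2 ^ N) ^ p else 0) with hb₂
  have hb : ∀ N, |rowDiffs l (frdPiecePow A m N) x y| ≤ b₁ N + b₂ N := by
    intro N
    have hb₁0 : 0 ≤ b₁ N := by simp only [hb₁]; split_ifs <;> positivity
    have hb₂0 : 0 ≤ b₂ N := by simp only [hb₂]; split_ifs <;> positivity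
    by_cases hΛ : (2 : ℝ) ^ N ≤ Λ
    · by_cases hθ : θ ≤ (2 : ℝ) ^ N
      · refine (h3D N hΛ).trans ?_
        simp only [hb₁, if_pos hθ]
        linarith
      · rw [hvan N (lt_of_not_ge hθ), abs_zero]
        exact add_nonneg hb₁0 hb₂0
    · have hΛ' : Λ < (2 : ℝ) ^ N := lt_of_not_ge hΛ
      by_cases hθ : θ ≤ (2 : ℝ) ^ N
      · refine (hfar N hΛ').trans ?_
        simp only [hb₂, if_pos (max_le hθ hΛ'.le)]
        nlinarith
      · rw [hvan N (lt_of_not_ge hθ), abs_zero]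
        exact add_nonneg hb₁0 hb₂0
  have hs₁ : Summable b₁ := (summable_indicator_inv_two_pow θ hq).mul_left K₃
  have hs₂ : Summable b₂ := (summable_indicator_inv_two_pow (max θ Λ) hp).mul_left (Kf * E)
  have htot := abs_rowDiffs_pinv_le_tsum hA hs hP h4 h0 ha₀ hmin hm hl x y hb (hs₁.add hs₂)
  refine htot.trans ?_
  rw [hs₁.tsum_add hs₂]
  simp only [hb₁, hb₂]
  rw [tsum_mul_left, tsum_mul_left]
  have h1 := tsum_indicator_inv_two_pow_le θ hq
  have h2 := tsum_indicator_inv_two_pow_le (max θ Λ) hp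
  calc K₃ * ∑' N, (if θ ≤ (2 : ℝ) ^ N then ((1 : ℝ) / 2 ^ N) ^ q else 0)
        + Kf * E * ∑' N, (if max θ Λ ≤ (2 : ℝ) ^ N then ((1 : ℝ) / 2 ^ N) ^ p else 0)
      ≤ K₃ * (2 * (1 / max 1 θ) ^ q) + Kf * E * (2 * (1 / max 1 (max θ Λ)) ^ p) :=
        add_le_add (mul_le_mul_of_nonneg_left h1 hK₃) (mul_le_mul_of_nonneg_left h2 (mul_nonneg hKf hE))
    _ = 2 * K₃ * (1 / max 1 θ) ^ q + 2 * Kf * (1 / max 1 (max θ Λ)) ^ p * E := by ring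

end Core

end Literature.Analysis.Matrix

end
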